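import Literature.NumberTheory.Transcendental.KZProductIdeal
import Literature.NumberTheory.Transcendental.KZSemiCanonicalReductionHolds
import Literature.NumberTheory.Transcendental.KZVolumeConjecture
import Literature.NumberTheory.Transcendental.KZMellinFibres
import Literature.NumberTheory.Transcendental.KZLogCalculusProofs
import Literature.NumberTheory.Transcendental.KZCalculusProofs
import Summits.KontsevichZagierPeriods.KontsevichZagierPeriods.Theorems.ReducedPeriodRing.Negative.ModelsAnatomy

/-!
# `KZ.PiCancellation` (item stmt-KontsevichZagierPeriods-0540) in equivalent forms:
# generators, cylinder rigidity of semialgebraic bodies, lifting of relations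

`Literature.NumberTheory.Transcendental.KZ.PiCancellation` (`[π]·c ∈ relations → c ∈ relations`,
`[π] = [{x² + y² ≤ 1}, 1]`; item stmt-KontsevichZagierPeriods-0540 = `AyoubPiCancellation` of routes
AyoubSpecialisation / HurwitzMicroSectors, `PiCancellation` of KatzTower) is an OPEN thesis; it is
also, verbatim, the residual stub `stub_piCancellation` of crux `NormalFormPrinciple`
(stmt-KontsevichZagierPeriods-3869, line `SketchIdeator1`). Nothing in the tree discharges it (the
landed lemmas consume it — `statement_of_leaves`, `normalFormPrinciple_of_leaves`,
`mem_of_piPow_mem` — or derive it from the summit, `leaves_of_statement`,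
`KZ.piCancellation_of_kernel`). This support file records what the tree's reduction machinery DOES
give for it — equivalent forms, each proved from tree lemmas only
(`KZ.exists_integralRep_sub_holds`, `KZ.exists_sub_add_mem_relations_sign`,
`KZ.exists_boundedVolume_sub_mem_relations`, `KZ.exists_merge₂`,
`KZ.exists_isCompact_of_sub_of_sub_mem_relations`, `KZ.exists_closure_of_integrand_one`,
`KZ.piRep_mul_mem_relations`):

* `piCancellation_iff_generator` — it suffices to cancel `[π]` in front of ONE representation;
* `piCancellation_iff_cylinder` — **cylinder rigidity of bounded semialgebraic bodies**: for bounded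
  bodies `A, B ⊆ ℝᴺ` (integrand `1`, one common dimension), `disc × A ∼ disc × B → A ∼ B`;
* `piCancellation_iff_compactCylinder` — the same with `A`, `B` COMPACT and TOP-DIMENSIONAL, i.e.
  in the exact vocabulary of the Cresson–Viu-Sos volume conjecture `KZ.volumeConjectureCompact`,
  whose hypothesis `vol K₁ = vol K₂` is replaced by `disc × K₁ ∼ disc × K₂`; hence
  `piCancellation_of_volumeConjectureCompact` in three lines (soundness: `π·vol K₁ = π·vol K₂`);
* `piCancellation_iff_lift` — **relations among cylinders are cylinders over relations**:
  `[π] * ·` is injective on the free group `FormalRep` (`piMul_injective`), so `PiCancellation` holds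
  iff every relation of the form `[π]·c` equals `[π]·d` for a relation `d`;
* `piCancellationOn_of_kernelOn` — every partial kernel result is a partial cancellation result.

On the way (starting from the tree's `ReducedPeriodRingNegative.exists_sub_of_mem_relations`: every
formal combination is ONE representation modulo moves): every formal combination is a difference
of two bounded volumes of one dimension (`exists_sub_boundedVolume_sub_mem_relations`), and — if it
evaluates to `0` — a difference of two compact top-dimensional bodies of one dimension
(`exists_sub_compact_sub_mem_relations_of_eval`). Theorems only; nothing is claimed about
`PiCancellation` itself. Sources: M. Kontsevich, D. Zagier, *Periods* (2001), §1.2, §4.1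
(`P̂ = P[1/2πi]`); J. Viu-Sos, *A semi-canonical reduction for periods of Kontsevich–Zagier*, IJNT 17
(2021), Thm. 1.1, Cor. 2.3, §4; J. Cresson, J. Viu-Sos, JTNB 34 (2022), §1 (volume conjecture);
A. Huber, G. Wüstholz, *Transcendence and Linear Relations of 1-Periods* (2022), App. A.4 (the
motivic shadow of `PiCancellation` is an open question).
-/

noncomputable section

open MeasureTheory Set
open Literature.NumberTheory.Transcendental Literature.NumberTheory.Transcendental.KZ
open Literature.ModelTheory.ExponentialFields (IsSemialgebraic)
open Summit.KontsevichZagierPeriods.KontsevichZagierPeriods.ReducedPeriodRingNegative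
  (exists_sub_of_mem_relations)

namespace Summit.KontsevichZagierPeriods.AyoubSpecialisation.PiCancellationForms

variable {n m : ℕ}

/-! ## Two bounded volumes, two compact bodies per formal combination -/

/-- **Two bounded volumes per formal combination** (Viu-Sos' decomposition, formal version): every
`c : FormalRep` differs by a relation from `[A] − [B]` with `A`, `B` representations of ONE common
positive dimension, bounded domains and integrand `1` on them (one representation by
`ReducedPeriodRingNegative.exists_sub_of_mem_relations`, sign splitting
`KZ.exists_sub_add_mem_relations_sign`, and
`KZ.exists_boundedVolume_sub_mem_relations` on both parts). [cite: ViuSos2021, Cor. 2.3] -/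
theorem exists_sub_boundedVolume_sub_mem_relations (c : FormalRep) :
    ∃ (N : ℕ) (A B : IntegralRep (N + 1)), Bornology.IsBounded A.domain ∧
      (∀ z ∈ A.domain, A.integrand z = 1) ∧ Bornology.IsBounded B.domain ∧
      (∀ z ∈ B.domain, B.integrand z = 1) ∧ c - (of A - of B) ∈ relations := by
  obtain ⟨N, R, hR⟩ := exists_sub_of_mem_relations c
  obtain ⟨p, q, hp, hq, hpq⟩ := exists_sub_add_mem_relations_sign R
  obtain ⟨A, hAb, hA1, hA⟩ := exists_boundedVolume_sub_mem_relations p hp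
  obtain ⟨B, hBb, hB1, hB⟩ := exists_boundedVolume_sub_mem_relations q hq
  refine ⟨N, A, B, hAb, hA1, hBb, hB1, ?_⟩
  have e : c - (of A - of B) = (c - of R) + (of R - of p + of q) + (of p - of A) - (of q - of B) := by
    abel
  rw [e]
  exact relations.sub_mem (relations.add_mem (relations.add_mem hR hpq) hA) hB

/-- **The open unit box as a representation**: in every dimension there is a representation with
domain the open unit box `(0,1)ᵈ`, integrand `1`, bounded domain of positive volume and value `1`.
[cite: KontsevichZagier2001, §1.1] -/
theorem exists_unitBoxRep (d : ℕ) :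
    ∃ Q : IntegralRep d, Q.domain = Set.pi univ (fun _ => Ioo (0:ℝ) 1) ∧ (Q.integrand = fun _ => 1) ∧
      Bornology.IsBounded Q.domain ∧ 0 < volume Q.domain ∧ Q.value = 1 := by
  have hset : {x : Fin d → ℝ | ∀ j, x j ∈ Ioo (0:ℝ) 1} = Set.pi univ (fun _ => Ioo (0:ℝ) 1) := by
    ext x; simp
  have hsa : IsSemialgebraic ℚ (Set.pi univ (fun _ : Fin d => Ioo (0:ℝ) 1)) := hset ▸ isSemialgebraic_box d
  have hb : Bornology.IsBounded (Set.pi univ (fun _ : Fin d => Ioo (0:ℝ) 1)) :=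
    Bornology.IsBounded.pi fun _ => Metric.isBounded_Ioo _ _
  obtain ⟨Q, hQd, hQi⟩ := exists_oneRep hsa hb.measure_lt_top.ne
  have hvol : volume (Set.pi univ (fun _ : Fin d => Ioo (0:ℝ) 1)) = 1 := by
    rw [Real.volume_pi_Ioo]; simp
  refine ⟨Q, hQd, hQi, hQd ▸ hb, by rw [hQd, hvol]; exact one_pos, ?_⟩
  rw [Q.value_eq_volume_real (fun z _ => by simp [hQi]), measureReal_def, hQd, hvol]
  simp

/-- **Two compact top-dimensional bodies per formal combination of value `0`**: if `eval c = 0`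
then `c ≡ [K₁] − [K₂]` with `K₁`, `K₂` representations of ONE common positive dimension with
COMPACT domains of NON-EMPTY INTERIOR and integrand `1` (the vocabulary of
`KZ.volumeConjectureCompact`). From the bounded pair `[A] − [B]` (equal volumes by soundness): add
the unit box `Q`, merge `[A] + [Q] ≡ [K_A]` (`KZ.exists_merge₂`), pack `[K_A] − [B] ≡ [K]` with `K`
compact top-dimensional (`KZ.exists_isCompact_of_sub_of_sub_mem_relations`, `vol B < vol K_A`), and
close up `Q` (`KZ.exists_closure_of_integrand_one`). [cite: ViuSos2021, §4] -/
theorem exists_sub_compact_sub_mem_relations_of_eval (c : FormalRep) (hc : eval c = 0) :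
    ∃ (N : ℕ) (K₁ K₂ : IntegralRep (N + 1)),
      IsCompact K₁.domain ∧ (interior K₁.domain).Nonempty ∧ (∀ z ∈ K₁.domain, K₁.integrand z = 1) ∧
      IsCompact K₂.domain ∧ (interior K₂.domain).Nonempty ∧ (∀ z ∈ K₂.domain, K₂.integrand z = 1) ∧
      c - (of K₁ - of K₂) ∈ relations := by
  obtain ⟨N, A, B, hAb, hA1, hBb, hB1, hcAB⟩ := exists_sub_boundedVolume_sub_mem_relations c
  obtain ⟨Q, hQd, hQi, hQb, hQpos, hQv⟩ := exists_unitBoxRep (N + 1)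
  have hQ1 : ∀ z ∈ Q.domain, Q.integrand z = 1 := fun z _ => by simp [hQi]
  obtain ⟨KA, hKAb, hKA1, hAQ⟩ := exists_merge₂ A Q hAb hQb hA1 hQ1
  -- values by soundness
  have hvAB : A.value = B.value := by
    have h := relations_le_ker_eval_holds hcAB
    rw [AddMonoidHom.mem_ker, map_sub, map_sub, eval_of, eval_of, hc] at h
    linarith
  have hvKA : KA.value = A.value + 1 := by
    have h := relations_le_ker_eval_holds hAQ
    rw [AddMonoidHom.mem_ker, map_sub, map_add, eval_of, eval_of, eval_of, hQv] at h
    linarith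
  obtain ⟨K, hKc, hKint, hK1, hK⟩ :=
    exists_isCompact_of_sub_of_sub_mem_relations KA B hKAb hBb hKA1 hB1 (by linarith)
  obtain ⟨KQ, -, hKQi, hKQc, hKQint, hQK⟩ := exists_closure_of_integrand_one Q hQ1 hQb
  refine ⟨N, K, KQ, hKc, hKint, hK1, hKQc, hKQint hQpos, fun z _ => by simp [hKQi], ?_⟩
  have e : c - (of K - of KQ) =
      (c - (of A - of B)) + (of A + of Q - of KA) + (of KA - of B - of K) - (of Q - of KQ) := by abel
  rw [e]
  exact relations.sub_mem (relations.add_mem (relations.add_mem hcAB hAQ) hK) hQK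

/-! ## Form 1: single generators -/

/-- **`PiCancellation` on generators suffices**: `[π]` is cancellable in front of every formal
combination iff it is cancellable in front of every single representation,
`[π]·[r] ∈ relations → [r] ∈ relations` (reduce `c ≡ [R]` by
`ReducedPeriodRingNegative.exists_sub_of_mem_relations` and use
`[π] * relations ⊆ relations`, `KZ.piRep_mul_mem_relations`). [folklore] -/
theorem piCancellation_iff_generator :
    PiCancellation ↔ ∀ (n : ℕ) (r : IntegralRep n), of piRep * of r ∈ relations → of r ∈ relations := by
  refine ⟨fun h n r hr => h (of r) hr, fun h c hc => ?_⟩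
  obtain ⟨N, R, hR⟩ := exists_sub_of_mem_relations c
  have h1 : of piRep * of R ∈ relations := by
    have h2 := relations.sub_mem hc (piRep_mul_mem_relations hR)
    have e : of piRep * of R = of piRep * c - of piRep * (c - of R) := by simp only [mul_sub]; abel
    rwa [e]
  have e : c = (c - of R) + of R := by abel
  rw [e]
  exact relations.add_mem hR (h N R h1)

/-- **Partial kernel results are partial cancellation results.** On any set `S` of formal
combinations on which the kernel conjecture is known (`eval c = 0 → c ∈ relations` for `c ∈ S`),
`[π]` cancels: `[π]·c ∈ relations` forces `eval c = 0` by soundness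
(`KZ.eval_eq_zero_of_piRep_mul_mem_relations`). This is `KZ.piCancellation_of_kernel` relativised;
it turns every landed kernel layer (e.g. the dlog / split / real-split box layers of crux
stmt-KontsevichZagierPeriods-3869) into an unconditional instance of `PiCancellation`. [folklore] -/
theorem piCancellationOn_of_kernelOn {S : Set FormalRep}
    (hS : ∀ c ∈ S, eval c = 0 → c ∈ relations) {c : FormalRep} (hcS : c ∈ S)
    (hc : of piRep * c ∈ relations) : c ∈ relations :=
  hS c hcS (eval_eq_zero_of_piRep_mul_mem_relations relations_le_ker_eval_holds hc)

/-! ## Form 2: cylinder rigidity of bounded, resp. compact top-dimensional, semialgebraic bodies -/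

/-- **`PiCancellation` is cylinder rigidity.** `[π]·[A] = [disc × A, 1]` is the solid cylinder over
`A` (`KZ.of_mul_of`, `IntegralRep.piRep_prod_domain`). `PiCancellation` holds iff for all
representations `A`, `B` of one common dimension with BOUNDED domains and integrand `1` on them,
KZ-equivalence of the cylinders `[π]·A ∼ [π]·B` implies `A ∼ B`. (`→`: the hypothesis is
`[π]·([A] − [B]) ∈ relations`; `←`: write `c ≡ [A] − [B]` by
`exists_sub_boundedVolume_sub_mem_relations`, multiply the congruence by `[π]`
(`KZ.piRep_mul_mem_relations`), cancel on the pair, and add back.) [folklore] -/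
theorem piCancellation_iff_cylinder :
    PiCancellation ↔ ∀ (N : ℕ) (A B : IntegralRep N),
      Bornology.IsBounded A.domain → (∀ z ∈ A.domain, A.integrand z = 1) →
      Bornology.IsBounded B.domain → (∀ z ∈ B.domain, B.integrand z = 1) →
      Equivalent (piRep.prod A) (piRep.prod B) → Equivalent A B := by
  constructor
  · intro h N A B _ _ _ _ hAB
    refine h (of A - of B) ?_
    rw [mul_sub, of_mul_of, of_mul_of]
    exact hAB
  · intro h c hc
    obtain ⟨N, A, B, hAb, hA1, hBb, hB1, hcAB⟩ := exists_sub_boundedVolume_sub_mem_relations c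
    have h1 : of piRep * (of A - of B) ∈ relations := by
      have h2 := relations.sub_mem hc (piRep_mul_mem_relations hcAB)
      have e : of piRep * (of A - of B) = of piRep * c - of piRep * (c - (of A - of B)) := by
        simp only [mul_sub]; abel
      rwa [e]
    have hAB : Equivalent (piRep.prod A) (piRep.prod B) := by
      have h3 := h1
      rw [mul_sub, of_mul_of, of_mul_of] at h3
      exact h3
    have e : c = (c - (of A - of B)) + (of A - of B) := by abel
    rw [e]
    exact relations.add_mem hcAB (h (N + 1) A B hAb hA1 hBb hB1 hAB)

/-- **`PiCancellation` is cylinder rigidity of compact top-dimensional bodies** — the statement of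
the Cresson–Viu-Sos volume conjecture `KZ.volumeConjectureCompact` with its hypothesis
`vol K₁ = vol K₂` replaced by KZ-equivalence of the solid cylinders `disc × K₁ ∼ disc × K₂`:
`PiCancellation` holds iff for all representations `K₁`, `K₂` of one common dimension with compact
domains of non-empty interior and integrand `1` on them, `[π]·K₁ ∼ [π]·K₂ → K₁ ∼ K₂`.
(`←`: `[π]·c ∈ relations` forces `eval c = 0` by soundness, so
`exists_sub_compact_sub_mem_relations_of_eval` applies.) [cite: CressonViusos2022, §1 p. 326] -/
theorem piCancellation_iff_compactCylinder :
    PiCancellation ↔ ∀ (d : ℕ) (K₁ K₂ : IntegralRep d),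
      IsCompact K₁.domain → (interior K₁.domain).Nonempty →
      IsCompact K₂.domain → (interior K₂.domain).Nonempty →
      (∀ x ∈ K₁.domain, K₁.integrand x = 1) → (∀ x ∈ K₂.domain, K₂.integrand x = 1) →
      Equivalent (piRep.prod K₁) (piRep.prod K₂) → Equivalent K₁ K₂ := by
  constructor
  · intro h d K₁ K₂ _ _ _ _ _ _ hK
    refine h (of K₁ - of K₂) ?_
    rw [mul_sub, of_mul_of, of_mul_of]
    exact hK
  · intro h c hc
    have hc0 : eval c = 0 := eval_eq_zero_of_piRep_mul_mem_relations relations_le_ker_eval_holds hc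
    obtain ⟨N, K₁, K₂, h₁c, h₁i, h₁1, h₂c, h₂i, h₂1, hcK⟩ :=
      exists_sub_compact_sub_mem_relations_of_eval c hc0
    have h1 : of piRep * (of K₁ - of K₂) ∈ relations := by
      have h2 := relations.sub_mem hc (piRep_mul_mem_relations hcK)
      have e : of piRep * (of K₁ - of K₂) = of piRep * c - of piRep * (c - (of K₁ - of K₂)) := by
        simp only [mul_sub]; abel
      rwa [e]
    have hK : Equivalent (piRep.prod K₁) (piRep.prod K₂) := by
      have h3 := h1
      rw [mul_sub, of_mul_of, of_mul_of] at h3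
      exact h3
    have e : c = (c - (of K₁ - of K₂)) + (of K₁ - of K₂) := by abel
    rw [e]
    exact relations.add_mem hcK (h (N + 1) K₁ K₂ h₁c h₁i h₂c h₂i h₁1 h₂1 hK)

/-- **The volume conjecture implies `PiCancellation`, directly**: KZ-equivalent cylinders have equal
values `π · vol K₁ = π · vol K₂` (soundness, `IntegralRep.value_piRep_prod`), hence
`vol K₁ = vol K₂`, and `KZ.volumeConjectureCompact` makes the bodies equivalent
(`piCancellation_iff_compactCylinder`). (The tree also knows the long way round:
volume conjecture ⇒ Conjecture 1 ⇒ kernel conjecture ⇒ `PiCancellation`.)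
[cite: CressonViusos2022, §1 p. 326] -/
theorem piCancellation_of_volumeConjectureCompact (hV : volumeConjectureCompact) : PiCancellation := by
  refine piCancellation_iff_compactCylinder.mpr fun d K₁ K₂ h₁c h₁i h₂c h₂i h₁1 h₂1 hK => ?_
  refine hV K₁ K₂ h₁c h₁i h₂c h₂i h₁1 h₂1 ?_
  have h := relations_le_ker_eval_holds hK
  rw [AddMonoidHom.mem_ker, map_sub, eval_of, eval_of, IntegralRep.value_piRep_prod,
    IntegralRep.value_piRep_prod, sub_eq_zero] at h
  exact mul_left_cancel₀ Real.pi_ne_zero h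

/-! ## Form 3: relations among cylinders are cylinders over relations -/

/-- **The cylinder determines its base**: `r ↦ [π]·r = disc × r` is injective on representations
of a fixed dimension (the disc contains `0`, so the fibre of `disc × σ` over `0` is `σ`, and the
integrand `1 ⊗ f` restricted to that fibre is `f`). [folklore] -/
theorem piRep_prod_injective : Function.Injective (fun r : IntegralRep n => piRep.prod r) := by
  intro r r' h
  have h0 : (0 : Fin 2 → ℝ) ∈ piRep.domain := by simp
  have hd : r.domain = r'.domain := by
    have hd' := congrArg IntegralRep.domain h
    simp only [IntegralRep.prod_domain] at hd'
    ext x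
    have hx := congrArg (fun s => Fin.append (0 : Fin 2 → ℝ) x ∈ s) hd'
    simp only [IntegralRep.append_mem_prodDomain, h0, true_and, eq_iff_iff] at hx
    exact hx
  have hi : r.integrand = r'.integrand := by
    have hi' := congrArg IntegralRep.integrand h
    simp only [IntegralRep.piRep_prod_integrand] at hi'
    ext x
    have hx := congrArg (fun F => F (Fin.append (0 : Fin 2 → ℝ) x)) hi'
    simpa [IntegralRep.prodFun_append] using hx
  rcases r with ⟨σ, f, h1, h2, h3⟩
  rcases r' with ⟨σ', f', h1', h2', h3'⟩
  simp only at hd hi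
  subst hd
  subst hi
  rfl

/-- The generator map `⟨n, r⟩ ↦ ⟨2 + n, [π]·r⟩` underlying `[π] * ·` is injective. [folklore] -/
theorem sigma_piRep_prod_injective :
    Function.Injective (fun y : Σ k, IntegralRep k => (⟨2 + y.1, piRep.prod y.2⟩ : Σ k, IntegralRep k)) := by
  rintro ⟨k, r⟩ ⟨k', r'⟩ h
  simp only [Sigma.mk.inj_iff] at h
  obtain ⟨hk, hr⟩ := h
  obtain rfl : k = k' := by omega
  obtain rfl : r = r' := piRep_prod_injective (eq_of_heq hr)
  rfl

/-- **`[π] * ·` is injective on the free group `FormalRep`**: it is the endomorphism of the free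
abelian group induced by the injective generator map `⟨n, r⟩ ↦ ⟨2 + n, [π]·r⟩`, and it has the
additive left inverse sending a cylinder generator `⟨2 + n, [π]·r⟩` to `[r]` and every other
generator to `0`. No relations are involved. [folklore] -/
theorem piMul_injective : Function.Injective (fun c : FormalRep => of piRep * c) := by
  classical
  -- an additive left inverse on generators
  obtain ⟨L, hL⟩ : ∃ L : FormalRep →+ FormalRep, ∀ y : Σ k, IntegralRep k,
      L (FreeAbelianGroup.of ⟨2 + y.1, piRep.prod y.2⟩) = FreeAbelianGroup.of y := by
    refine ⟨FreeAbelianGroup.lift fun x : Σ k, IntegralRep k =>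
      if h : ∃ y : Σ k, IntegralRep k, x = ⟨2 + y.1, piRep.prod y.2⟩ then FreeAbelianGroup.of h.choose
      else 0, fun y => ?_⟩
    have hex : ∃ y' : Σ k, IntegralRep k,
        (⟨2 + y.1, piRep.prod y.2⟩ : Σ k, IntegralRep k) = ⟨2 + y'.1, piRep.prod y'.2⟩ := ⟨y, rfl⟩
    rw [FreeAbelianGroup.lift_apply_of, dif_pos hex]
    congr 1
    exact (sigma_piRep_prod_injective hex.choose_spec).symm
  have hleft : Function.LeftInverse L (fun c : FormalRep => of piRep * c) := by
    intro c
    simp only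
    induction c using FreeAbelianGroup.induction_on with
    | zero => simp
    | of y =>
      have e : of piRep * FreeAbelianGroup.of y =
          FreeAbelianGroup.of (⟨2 + y.1, piRep.prod y.2⟩ : Σ k, IntegralRep k) := by
        rw [of, FreeAbelianGroup.of_mul_of, sigma_mul_def]
      rw [e, hL]
    | neg y ih => rw [mul_neg, map_neg, ih]
    | add x y hx hy => rw [mul_add, map_add, hx, hy]
  exact hleft.injective

/-- **`PiCancellation` as a lifting property of relations.** Since `[π] * ·` is injective on
`FormalRep` (`piMul_injective`) and maps relations to relations (`KZ.piRep_mul_mem_relations`),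
`PiCancellation` holds iff every relation among cylinders is the cylinder over a relation:
`[π]·c ∈ relations → ∃ d ∈ relations, [π]·c = [π]·d`. [folklore] -/
theorem piCancellation_iff_lift :
    PiCancellation ↔ ∀ c : FormalRep, of piRep * c ∈ relations →
      ∃ d ∈ relations, of piRep * c = of piRep * d := by
  refine ⟨fun h c hc => ⟨c, h c hc, rfl⟩, fun h c hc => ?_⟩
  obtain ⟨d, hd, he⟩ := h c hc
  obtain rfl : c = d := piMul_injective he
  exact hd

end Summit.KontsevichZagierPeriods.AyoubSpecialisation.PiCancellationForms
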